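import Mathlib
import Summits.AnomalousDissipation.AnomalousDissipation.Theorems.SoloBlindMonodromyTaylor

/-!
# Continuation of a resolvent bound off a certified slice (solo-blind s80, §24.90(12): R5 by continuity)

The (MB) certificate bounds `‖(1 − M(P, z₀))⁻¹‖ ≤ C` for all `P` in a compact range, on the SLICE
`z = z₀` of the remaining parameters `z = (κ, y)` (the wavenumber-squared `κ = k² → 0⁺` limit system
and the cusp leaf `y = y*`).  In the assembly (24.A_w) the width `w` of the leaf tube and the
threshold `κ₀` (equivalently `n₀`) are FREE, so no Taylor model in `(κ, y)` is needed: joint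
continuity of the monodromy `M(P, z)` and compactness give a neighbourhood `dist z z₀ ≤ ρ` on which
`1 − M(P, z)` stays invertible with `‖(1 − M(P, z))⁻¹‖ ≤ 2C`, uniformly in `P`.

* `resolvent_bound_near_slice` — the statement above, from uniform continuity on the compact set
  `S ×ˢ closedBall z₀ r` and the Neumann step `one_sub_inverse_of_near` (kernel #139).
-/

open Set Metric

namespace Summit.AnomalousDissipation.AnomalousDissipation.Theorems

variable {A : Type*} [NormedRing A] [NormOneClass A] [CompleteSpace A]
variable {X Z : Type*} [PseudoMetricSpace X] [PseudoMetricSpace Z] [ProperSpace Z]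

/-- **Continuation off a certified slice.**  `S` compact, `M` jointly continuous on
`S ×ˢ closedBall z₀ r` (`r > 0`), and on the slice `z = z₀`: `1 − M(p, z₀)` invertible with
`‖(1 − M(p, z₀))⁻¹‖ ≤ C` for all `p ∈ S` (`C > 0`).  Then there is `ρ ∈ (0, r]` such that for all
`p ∈ S` and all `z` with `dist z z₀ ≤ ρ`: `1 − M(p, z)` is invertible and `‖(1 − M(p, z))⁻¹‖ ≤ 2C`. -/
theorem resolvent_bound_near_slice {S : Set X} (hS : IsCompact S) (M : X → Z → A) {z₀ : Z}
    {r C : ℝ} (hr : 0 < r) (hC : 0 < C)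
    (hcont : ContinuousOn (fun q : X × Z => M q.1 q.2) (S ×ˢ closedBall z₀ r))
    (hslice : ∀ p ∈ S, IsUnit (1 - M p z₀) ∧ ‖Ring.inverse (1 - M p z₀)‖ ≤ C) :
    ∃ ρ, 0 < ρ ∧ ρ ≤ r ∧ ∀ p ∈ S, ∀ z, dist z z₀ ≤ ρ →
      IsUnit (1 - M p z) ∧ ‖Ring.inverse (1 - M p z)‖ ≤ 2 * C := by
  have hK : IsCompact (S ×ˢ closedBall z₀ r) := hS.prod (isCompact_closedBall z₀ r)
  have huc := hK.uniformContinuousOn_of_continuous hcont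
  rw [Metric.uniformContinuousOn_iff] at huc
  have hε : (0 : ℝ) < 1 / (2 * C) := by positivity
  obtain ⟨δ, hδ, hδε⟩ := huc (1 / (2 * C)) hε
  refine ⟨min r (δ / 2), lt_min hr (by linarith), min_le_left _ _, ?_⟩
  intro p hp z hz
  have hzr : dist z z₀ ≤ r := hz.trans (min_le_left _ _)
  have hzδ : dist z z₀ < δ := lt_of_le_of_lt (hz.trans (min_le_right _ _)) (by linarith)
  have hx : (p, z) ∈ S ×ˢ closedBall z₀ r := ⟨hp, by simpa [mem_closedBall] using hzr⟩
  have hy : (p, z₀) ∈ S ×ˢ closedBall z₀ r := ⟨hp, by simp [mem_closedBall, hr.le]⟩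
  have hd : dist (p, z) (p, z₀) < δ := by
    rw [Prod.dist_eq]; simp [dist_self, hzδ]
  have hnear : ‖M p z - M p z₀‖ ≤ 1 / (2 * C) := by
    have := hδε (p, z) hx (p, z₀) hy hd
    rw [dist_eq_norm] at this
    exact this.le
  obtain ⟨hu, hb⟩ := hslice p hp
  have hη : 1 / (2 * C) * C < 1 := by
    rw [one_div, inv_mul_eq_div, div_lt_one (by positivity)]; linarith
  obtain ⟨hunit, hbound⟩ := one_sub_inverse_of_near hu hb hnear hη
  refine ⟨hunit, hbound.trans (le_of_eq ?_)⟩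
  field_simp
  ring

end Summit.AnomalousDissipation.AnomalousDissipation.Theorems
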